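import Summits.Ventures.PackingBounds.Configurations.Dim23Card552

/-!
# A hyperplane section of the `552`-point configuration: `A(22, arccos 1/5) ≥ 352`

Framing: lottery ticket; floor = certified bounds/negative ranges. Venture `PackingBounds` (cell `pub-packcert`, seat
`pub-packcert-sdp`), ATTAINED side of the B2c cell `(22, 1/5)` (certified three-point value `440`; attained entry so far
`338` = the `(21, 336, 1/5)` code with two poles, `SphericalCodes/CodeLiftRows.lean`). The tree's sharp `552`-point
configuration of `S²²` (`Config.Dim23Card552`: the `276` equiangular line pairs at cosine `±1/5`, Leech-lattice rows of
squared length `80` in `ℤ²⁴` orthogonal to the normal `(5, 1²³)`, pairwise dot products `16, -16, -80`, kernel-checked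
there) has `352` members with equal first two coordinates; they lie in the hyperplane orthogonal to
`(7, -13, -1²²)` (the projection of `e₀ - e₁` orthogonal to the normal), a `22`-space, and inherit unit norms and cosines
`≤ 1/5`: **`A(22, arccos 1/5) ≥ 352`**. The kernel counts the filtered rows and checks the two normals; norms and
inner products come from the tree's `35` histogram chunk theorems (reassembled inside the proof), no pairwise re-check (the proof is the
sub-configuration argument of `Config.exists_section_filter`, inlined because that module is not yet built on the farm).
Deeper central sections by octad-type normals give only `252, 180, 144, 112, 96, 72, 60` in dimensions `21, …, 15`
(seat script `code/gen16/explore/sec552.py`), below the existing rows.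

## References
* J. H. Conway, N. J. A. Sloane, *Sphere Packings, Lattices and Groups*, 3rd ed., Ch. 10 §3.5, Ch. 14 Theorem 1.
  [`ConwaySloane1999`]
* H. Cohn, A. Kumar, J. Amer. Math. Soc. 20 (2007) 99–148, Table 1 (`(23, 552)`). [`CohnKumar2006`]
-/

namespace Summit.Ventures.PackingBounds.Config.Card552Sections

open Finset Summit.Ventures.PackingBounds.Config Summit.Ventures.PackingBounds.Config.Dim23Card552

/-- Second normal: `(7, -13, -1, …, -1)`, the projection of `e₀ - e₁` orthogonal to the normal `(5, 1, …, 1)`. -/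
def n2 : List ℤ := [7, -13, -1, -1, -1, -1, -1, -1, -1, -1, -1, -1, -1, -1, -1, -1, -1, -1, -1, -1, -1, -1, -1, -1]

/-- The filter: rows orthogonal to `n2` (equivalently, with equal first two coordinates). -/
def p352 (u : List ℤ) : Bool := dotL n2 u == 0

/-- Normals of the section. -/
def normals352 : List (List ℤ) := normals ++ [n2]

/-- Kernel check: `352` of the `552` rows survive. -/
theorem length_352 : (vecs.filter p352).length = 352 := by decide +kernel

/-- Kernel check: two orthogonal nonzero normals of length `24`. -/
theorem normals352_ok : normalsOK normals352 24 = true := by decide +kernel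

set_option maxRecDepth 100000 in
/-- Kernel check: the filtered rows are orthogonal to both normals. -/
theorem orth352 : orthOK normals352 (vecs.filter p352) = true := by decide +kernel

set_option maxRecDepth 100000 in
/-- Kernel check: the filtered rows pass the shape check (length `24`, squared length `80`). -/
theorem shape352 : shapeOK (vecs.filter p352) 24 (80 : ℤ) = true := by decide +kernel

/-- `ι 80 > 0`. -/
private theorem hq : 0 < (Int.castRingHom ℝ) (80 : ℤ) := by simp

/-- **`A(22, arccos 1/5) ≥ 352`**: `352` unit vectors of `ℝ²²` with pairwise inner products `≤ 1/5` (a central hyperplane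
section of the `552`-point configuration; inner products `±1/5, -1`). [cite: ConwaySloane1999, Ch. 14 Theorem 1] -/
theorem exists_code_dim22_fifth_352 : ∃ C : Finset (EuclideanSpace ℝ (Fin 22)), C.card = 352 ∧
    (∀ x ∈ C, ‖x‖ = 1) ∧ ∀ x ∈ C, ∀ y ∈ C, x ≠ y → inner ℝ x y ≤ 1 / 5 := by
  have hι : Function.Injective (Int.castRingHom ℝ) := Int.cast_injective
  -- the distance distribution of the `552` rows: the tree's chunk checks `hist_0` … `hist_34` combined
  have hH : histOK vecs table vecs = true := by
    show histOK vecs table (vecs0 ++ vecs1 ++ vecs2 ++ vecs3 ++ vecs4 ++ vecs5 ++ vecs6 ++ vecs7 ++ vecs8 ++ vecs9 ++ vecs10 ++ vecs11 ++ vecs12 ++ vecs13 ++ vecs14 ++ vecs15 ++ vecs16 ++ vecs17 ++ vecs18 ++ vecs19 ++ vecs20 ++ vecs21 ++ vecs22 ++ vecs23 ++ vecs24 ++ vecs25 ++ vecs26 ++ vecs27 ++ vecs28 ++ vecs29 ++ vecs30 ++ vecs31 ++ vecs32 ++ vecs33 ++ vecs34) = true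
    simp only [histOK_append, hist_0, hist_1, hist_2, hist_3, hist_4, hist_5, hist_6, hist_7, hist_8, hist_9, hist_10, hist_11, hist_12, hist_13, hist_14, hist_15, hist_16, hist_17, hist_18, hist_19, hist_20, hist_21, hist_22, hist_23, hist_24, hist_25, hist_26, hist_27, hist_28, hist_29, hist_30, hist_31, hist_32, hist_33, hist_34, Bool.and_self]
  have hN : vecs.Nodup := nodup_of_checks shape_vecs keys_table hH
  have hsub : ∀ x ∈ config (Int.castRingHom ℝ) 24 (80 : ℤ) (vecs.filter p352),
      x ∈ config (Int.castRingHom ℝ) 24 (80 : ℤ) vecs := by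
    intro x hx
    obtain ⟨l, hl, rfl⟩ := mem_config.1 hx
    exact mem_config.2 ⟨l, (List.mem_filter.1 hl).1, rfl⟩
  obtain ⟨C', hcard, hnorm, hinner, _⟩ := exists_transfer_orthogonal (m := 24) (n := 22) (k := 2) (by decide)
    (fun i : Fin normals352.length => vec (Int.castRingHom ℝ) 24 (80 : ℤ) normals352[(i : ℕ)])
    (linearIndependent_normals hι hq normals352 normals352_ok)
    (config (Int.castRingHom ℝ) 24 (80 : ℤ) (vecs.filter p352))
    (inner_normals_eq_zero hq shape352 normals352 normals352_ok orth352)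
  refine ⟨C', ?_, ?_, ?_⟩
  · rw [hcard, config, List.toFinset_card_of_nodup, List.length_map, length_352]
    exact (hN.filter p352).map_on fun x hx y hy h =>
      vec_injOn hι hq shape_vecs keys_table hH x (List.mem_filter.1 hx).1 y (List.mem_filter.1 hy).1 h
  · intro x' hx'
    obtain ⟨x, hx, he⟩ := hnorm x' hx'
    rw [he]
    exact norm_eq_one hq shape_vecs x (hsub x hx)
  · intro x' hx' y' hy' hne
    obtain ⟨x, hx, y, hy, hxy, he⟩ := hinner x' hx' y' hy' hne
    rw [he]
    refine inner_le hq shape_vecs hH (1 / 5) (fun p hp => ?_) x (hsub x hx) y (hsub y hy) hxy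
    simp only [table, List.mem_cons, List.not_mem_nil, or_false] at hp
    rcases hp with rfl | rfl | rfl <;> norm_num

end Summit.Ventures.PackingBounds.Config.Card552Sections
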